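import Summits.MatrixMultiplication.MatrixMultiplication.Theorems.SoloInformedCwTwoBoundary
import HarnessLib

/-!
# Three more classes below the door over every ring (solo-informed, gen 25)

Addendum to `SoloInformedCwTwoCharTwo`: the normal forms `N₁₇`, `N₂₀ = ⟨2⟩ ⊕ 0` and `N₂₁ = W` are
RESTRICTIONS of `P = Σ_{σ∈𝔖₃} e_σ` by `0/1` matrices (order `0`, multiplier `1`), hence `P ⊵ N_k` over
every commutative ring — in particular in characteristic `2`, where the census certificates
(multipliers `6`, `4`, `6`) said nothing.  The rule behind all three: for columns that are standard
basis vectors `e_α, e_β, e_γ`, the entry `Σ_{(a,b,c) distinct} A_{a i} B_{b j} C_{c k}` of a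
restriction of `P` is `1` iff `α, β, γ` are pairwise distinct.

* `N₁₇ = e₀e₀e₁ + e₀e₁e₀ + e₁e₀e₂ + e₁e₂e₀` is `P` with the slice `P(0,·,·)` deleted
  (`A = (e₂, e₁, 0)`, `B = C = 1`);
* `N₂₀ = e₀e₀e₀ + e₁e₁e₁`: `A = (e₀, e₂, 0)`, `B = (e₁, e₀, 0)`, `C = (e₂, e₁, 0)`;
* `N₂₁ = e₀e₀e₁ + e₀e₁e₀ + e₁e₀e₀` (`W`): `A = (e₀, e₂, 0)`, `B = (e₁, e₂, 0)`, `C = (e₀ + e₁, e₂, 0)`.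

With the previous file the characteristic-`2` table of the `24` classes reads: `16` obstructed
(unimodular pencil), `6` below `P` over every ring (`N₁₇, N₁₉, N₂₀, N₂₁, N₂₃, N₂₄`), and only
`N₉`, `N₁₈` (border rank `3`, all pencil cubics `≡ 0 (mod 2)`) undecided.
-/

namespace Summit.MatrixMultiplication.MatrixMultiplication.Theorems

open Literature.Computability.AlgebraicComplexity
open Literature.Barriers.MatrixMultiplication (PolyDegeneratesTo)

/-- `P ⊵ N₁₇` by restriction: delete the slice `P(0,·,·)` (order `0`, multiplier `1`). -/
theorem sThree_nurmiev_17_unit_check :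
    DegenCert.check 3 3 3 3 3 3 0 1 sThreeInt (nurmievInt 17)
      ![![[], [], []], ![[], [1], []], ![[1], [], []]]
      ![![[1], [], []], ![[], [1], []], ![[], [], [1]]]
      ![![[1], [], []], ![[], [1], []], ![[], [], [1]]] = true := by
  decide +kernel

/-- `P ⊵ N₂₀ = e₀e₀e₀ + e₁e₁e₁` by restriction (order `0`, multiplier `1`). -/
theorem sThree_nurmiev_20_unit_check :
    DegenCert.check 3 3 3 3 3 3 0 1 sThreeInt (nurmievInt 20)
      ![![[1], [], []], ![[], [], []], ![[], [1], []]]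
      ![![[], [1], []], ![[1], [], []], ![[], [], []]]
      ![![[], [], []], ![[], [1], []], ![[1], [], []]] = true := by
  decide +kernel

/-- `P ⊵ N₂₁ = W` by restriction (order `0`, multiplier `1`). -/
theorem sThree_nurmiev_21_unit_check :
    DegenCert.check 3 3 3 3 3 3 0 1 sThreeInt (nurmievInt 21)
      ![![[1], [], []], ![[], [], []], ![[], [1], []]]
      ![![[], [], []], ![[1], [], []], ![[], [1], []]]
      ![![[1], [], []], ![[1], [], []], ![[], [1], []]] = true := by
  decide +kernel

/-- **`P ⊵ N_k` over every commutative ring for `k ∈ {17, 20, 21}`** (restrictions). -/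
theorem sThree_polyDegeneratesTo_nurmiev_of_mem_restriction (K : Type*) [CommRing K] (k : ℕ)
    (hk : k ∈ ({17, 20, 21} : Finset ℕ)) : PolyDegeneratesTo (sThree K) (nurmiev K k) := by
  simp only [Finset.mem_insert, Finset.mem_singleton] at hk
  rcases hk with rfl | rfl | rfl
  · exact DegenCert.polyDegeneratesTo_of_check_one K sThree_nurmiev_17_unit_check
  · exact DegenCert.polyDegeneratesTo_of_check_one K sThree_nurmiev_20_unit_check
  · exact DegenCert.polyDegeneratesTo_of_check_one K sThree_nurmiev_21_unit_check

/-- In particular `T_{cw,2} ⊵ W` over `ℂ` through a multiplier-`1` restriction of `P`. -/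
theorem cwTensor_two_polyDegeneratesTo_nurmiev_21_restriction :
    PolyDegeneratesTo (cwTensor ℂ 2) (nurmiev ℂ 21) :=
  cwTensor_two_restrictsTo_sThree.trans_polyDegeneratesTo
    (sThree_polyDegeneratesTo_nurmiev_of_mem_restriction ℂ 21 (by decide))

end Summit.MatrixMultiplication.MatrixMultiplication.Theorems
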